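import Mathlib
import Literature.AlgebraicGeometry.Resolution.CobordantGame
import Literature.AlgebraicGeometry.Resolution.CobordantChartCoefficients
import Literature.AlgebraicGeometry.Resolution.CobordantChartPlaneSlice
import Literature.AlgebraicGeometry.Resolution.PowerSeriesRegularLocal
import Literature.AlgebraicGeometry.Resolution.CurveBlowupPolygonLaws
import Literature.AlgebraicGeometry.Resolution.FormalCoordinateChange
import Summits.ResolutionOfSingularities.ResolutionOfSingularities.Theorems.WeightedInvariantLocalWeightedDropChartTransportTwo
import Summits.ResolutionOfSingularities.ResolutionOfSingularities.Theorems.WeightedInvariantLocalWeightedDropPointChartBeta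

/-!
# `LocalWeightedDrop`: CJS Lemma 12.4 on a game move — `α′ + 1 = α`, `β′ = β` under the blow-up of the curve `V(y, u₁)`

Route `ResolutionOfSingularities/WeightedInvariant`, crux `LocalWeightedDrop` (stmt-ResolutionOfSingularities-8899), line
`hasse-ridge-face-selection` (chain w43, [OURS · L1 W4.3]).  Companion of `…PointChartBeta` / `…ChartTwoBeta` for the CURVE
move: the landed Literature laws `CurveBlowupPolygonLaws.alphaS_colon_curve_add` (`α′ + L = α`) and `betaS_colon_curve_eq`
(`β′ = β`) applied to the game's blow-up of the curve `V(X₀, X₁)` (weights `(1, 1, 0)`) of `f ∈ k[[X₀, X₁, X₂]]` at an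
exceptional point `c = (c₀, c₁, 0)` with `c₁ ≠ 0`, sliced at the slot `1`, with the translated parameters
`c̃ = (X₀ − (c₀/c₁) X₁, X₁, X₂)` and chart parameters `c′ = (c₁⁻¹ X₁, c₁ X₀, X₂)` of `…ChartTransportTwo`:
`weakTransformCurve_eq_span_slice`, `alphaS_betaS_sliceCurve` (hypotheses: `(f) ⊆ (c̃₀, c̃₁)^d` — permissibility of the
curve in the translated parameters —, polygon non-empty, `δ > 1`, `α ≥ 1`, all scaled by `L = d!`).
-/

set_option linter.dupNamespace false -- mandated namespace of this single-conjunct summit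

namespace Summit.ResolutionOfSingularities.ResolutionOfSingularities.Theorems

open Literature.AlgebraicGeometry.Resolution

namespace PointChartTransport

variable {k : Type} [Field k]

/-- THE WEAK TRANSFORM OF THE CURVE CHART IS THE IDEAL OF THE SLICE: `((f) R′ : (φ u₁)^d) = (Sl)`, `u₁ = c̃₁ = X₁`. -/
theorem weakTransformCurve_eq_span_slice (c : Fin 3 → k) (hc1 : c 1 ≠ 0) (hc2 : c 2 = 0) (f : MvPowerSeries (Fin 3) k)
    (d : ℕ) (G : MvPowerSeries (Fin 4) k)
    (hfac : MvPowerSeries.subst (CobordantChart.chart (![1, 1, 0] : Fin 3 → ℕ) c) f = MvPowerSeries.X 0 ^ d * G) :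
    Submodule.colon (Ideal.map (MvPowerSeries.substAlgHom (R := k) (hasSubst_rhoCurve c hc2)).toRingHom (Ideal.span {f}))
        ({(MvPowerSeries.substAlgHom (R := k) (hasSubst_rhoCurve c hc2)).toRingHom
            (MvPowerSeries.X 1 : MvPowerSeries (Fin 3) k) ^ d} : Set (MvPowerSeries (Fin 3) k)) =
      Ideal.span {MvPowerSeries.subst (fun j : Fin 4 => if j = (1 : Fin 3).succ then
        (0 : MvPowerSeries (Fin 3) k) else MvPowerSeries.X (Fin.predAbove (1 : Fin 3) j)) G} := by
  have hφ : ∀ x, (MvPowerSeries.substAlgHom (R := k) (hasSubst_rhoCurve c hc2)).toRingHom x =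
      MvPowerSeries.subst (fun l : Fin 3 => MvPowerSeries.X (0 : Fin 3) ^ ((![1, 1, 0] : Fin 3 → ℕ) l) *
        (MvPowerSeries.C (c l) + if l = (1 : Fin 3) then (0 : MvPowerSeries (Fin 3) k)
          else MvPowerSeries.X (Fin.predAbove (1 : Fin 3) l.succ))) x := fun x => by
    rw [AlgHom.toRingHom_eq_coe, RingHom.coe_coe, MvPowerSeries.coe_substAlgHom]
  rw [Ideal.map_span, Set.image_singleton, hφ, hφ, substCurve_rho_eq c hc1 hc2 f d G hfac, substCurve_ct_one c hc2,
    colon_span_singleton_mul, Ideal.span_singleton_mul_left_unit]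
  · exact (MvPowerSeries.isUnit_iff_constantCoeff.mpr (by
      rw [MvPowerSeries.constantCoeff_C]; exact isUnit_iff_ne_zero.mpr (pow_ne_zero _ (inv_ne_zero hc1))))
  · exact pow_ne_zero _ (mul_ne_zero (fun h => hc1 (MvPowerSeries.C_injective (h.trans (map_zero _).symm)))
      (FormalCoordChange.X_ne_zero' _))

/-- **`α′ + d! = α` AND `β′ = β` UNDER THE CURVE MOVE OF THE GAME** (CJS Lemma 12.4 (4): translation by one unit, Literature
`CurveBlowupPolygonLaws.alphaS_colon_curve_add` / `betaS_colon_curve_eq`, instantiated; scaled integer invariants). -/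
theorem alphaS_betaS_sliceCurve (c : Fin 3 → k) (hc1 : c 1 ≠ 0) (hc2 : c 2 = 0) (f : MvPowerSeries (Fin 3) k) (d : ℕ)
    (G : MvPowerSeries (Fin 4) k)
    (hfac : MvPowerSeries.subst (CobordantChart.chart (![1, 1, 0] : Fin 3 → ℕ) c) f = MvPowerSeries.X 0 ^ d * G)
    (hJμ : Ideal.span {f} ≤ Ideal.span {(MvPowerSeries.X 0 - MvPowerSeries.C (c 0 / c 1) * MvPowerSeries.X 1 :
      MvPowerSeries (Fin 3) k), MvPowerSeries.X 1} ^ d)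
    (hne : (pts (![MvPowerSeries.X 0 - MvPowerSeries.C (c 0 / c 1) * MvPowerSeries.X 1, MvPowerSeries.X 1,
      MvPowerSeries.X 2] : Fin 3 → MvPowerSeries (Fin 3) k) (Ideal.span {f}) d).Nonempty)
    (hδ : d.factorial < deltaS (![MvPowerSeries.X 0 - MvPowerSeries.C (c 0 / c 1) * MvPowerSeries.X 1, MvPowerSeries.X 1,
      MvPowerSeries.X 2] : Fin 3 → MvPowerSeries (Fin 3) k) (Ideal.span {f}) d)
    (hα : d.factorial ≤ alphaS (![MvPowerSeries.X 0 - MvPowerSeries.C (c 0 / c 1) * MvPowerSeries.X 1, MvPowerSeries.X 1,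
      MvPowerSeries.X 2] : Fin 3 → MvPowerSeries (Fin 3) k) (Ideal.span {f}) d) :
    alphaS (![MvPowerSeries.C (c 1)⁻¹ * MvPowerSeries.X 1, MvPowerSeries.C (c 1) * MvPowerSeries.X 0, MvPowerSeries.X 2] :
        Fin 3 → MvPowerSeries (Fin 3) k)
      (Ideal.span {MvPowerSeries.subst (fun j : Fin 4 => if j = (1 : Fin 3).succ then
        (0 : MvPowerSeries (Fin 3) k) else MvPowerSeries.X (Fin.predAbove (1 : Fin 3) j)) G}) d + d.factorial =
      alphaS (![MvPowerSeries.X 0 - MvPowerSeries.C (c 0 / c 1) * MvPowerSeries.X 1, MvPowerSeries.X 1,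
        MvPowerSeries.X 2] : Fin 3 → MvPowerSeries (Fin 3) k) (Ideal.span {f}) d ∧
    betaS (![MvPowerSeries.C (c 1)⁻¹ * MvPowerSeries.X 1, MvPowerSeries.C (c 1) * MvPowerSeries.X 0, MvPowerSeries.X 2] :
        Fin 3 → MvPowerSeries (Fin 3) k)
      (Ideal.span {MvPowerSeries.subst (fun j : Fin 4 => if j = (1 : Fin 3).succ then
        (0 : MvPowerSeries (Fin 3) k) else MvPowerSeries.X (Fin.predAbove (1 : Fin 3) j)) G}) d =
      betaS (![MvPowerSeries.X 0 - MvPowerSeries.C (c 0 / c 1) * MvPowerSeries.X 1, MvPowerSeries.X 1,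
        MvPowerSeries.X 2] : Fin 3 → MvPowerSeries (Fin 3) k) (Ideal.span {f}) d := by
  haveI : IsRegularLocalRing (MvPowerSeries (Fin 3) k) := isRegularLocalRing_mvPowerSeries k (Fin 3)
  have hdim : ringKrullDim (MvPowerSeries (Fin 3) k) = 3 := by
    rw [ringKrullDim_mvPowerSeries, Nat.card_eq_fintype_card, Fintype.card_fin]
    rfl
  set φ : MvPowerSeries (Fin 3) k →+* MvPowerSeries (Fin 3) k :=
    (MvPowerSeries.substAlgHom (R := k) (hasSubst_rhoCurve c hc2)).toRingHom with hφdef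
  have hφ : ∀ x, φ x = MvPowerSeries.subst (fun l : Fin 3 => MvPowerSeries.X (0 : Fin 3) ^ ((![1, 1, 0] : Fin 3 → ℕ) l) *
      (MvPowerSeries.C (c l) + if l = (1 : Fin 3) then (0 : MvPowerSeries (Fin 3) k)
        else MvPowerSeries.X (Fin.predAbove (1 : Fin 3) l.succ))) x := fun x => by
    rw [hφdef, AlgHom.toRingHom_eq_coe, RingHom.coe_coe, MvPowerSeries.coe_substAlgHom]
  set ct : Fin 3 → MvPowerSeries (Fin 3) k := ![MvPowerSeries.X 0 - MvPowerSeries.C (c 0 / c 1) * MvPowerSeries.X 1,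
    MvPowerSeries.X 1, MvPowerSeries.X 2] with hct
  set cp : Fin 3 → MvPowerSeries (Fin 3) k := ![MvPowerSeries.C (c 1)⁻¹ * MvPowerSeries.X 1,
    MvPowerSeries.C (c 1) * MvPowerSeries.X 0, MvPowerSeries.X 2] with hcp
  have hct0 : ct 0 = MvPowerSeries.X 0 - MvPowerSeries.C (c 0 / c 1) * MvPowerSeries.X 1 := rfl
  have hct1 : ct 1 = MvPowerSeries.X 1 := rfl
  have hct2 : ct 2 = MvPowerSeries.X 2 := rfl
  have hcp0 : cp 0 = MvPowerSeries.C (c 1)⁻¹ * MvPowerSeries.X 1 := rfl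
  have hcp1 : cp 1 = MvPowerSeries.C (c 1) * MvPowerSeries.X 0 := rfl
  have hcp2 : cp 2 = MvPowerSeries.X 2 := rfl
  have h₁ : cp 1 = φ (ct 1) := by
    rw [hφ, hct1, hcp1, substCurve_ct_one c hc2]
  have h₀ : φ (ct 0) = φ (ct 1) * cp 0 := by
    rw [hφ, hφ, hct0, hct1, hcp0, substCurve_ct_zero c hc1 hc2, substCurve_ct_one c hc2]
  have h₂ : cp 2 = φ (ct 2) := by
    rw [hφ, hct2, hcp2, substCurve_ct_two c hc2]
  have hgen : Ideal.span {ct 0, ct 1, ct 2} = IsLocalRing.maximalIdeal _ := span_ctCurve_eq_maximalIdeal c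
  have hgen' : Ideal.span {cp 0, cp 1, cp 2} = IsLocalRing.maximalIdeal _ := span_cprimeCurve_eq_maximalIdeal c hc1
  have hJμ' : Ideal.span {f} ≤ Ideal.span {ct 0, ct 1} ^ d := by rw [hct0, hct1]; exact hJμ
  have hJ' : Submodule.colon (Ideal.map φ (Ideal.span {f})) ({φ (ct 1) ^ d} : Set (MvPowerSeries (Fin 3) k)) =
      Ideal.span {MvPowerSeries.subst (fun j : Fin 4 => if j = (1 : Fin 3).succ then
        (0 : MvPowerSeries (Fin 3) k) else MvPowerSeries.X (Fin.predAbove (1 : Fin 3) j)) G} := by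
    rw [hφdef]
    exact weakTransformCurve_eq_span_slice c hc1 hc2 f d G hfac
  have keyα := alphaS_colon_curve_add φ h₁ h₀ h₂ hgen hdim hgen' hdim hJμ' hne hδ hα
  have keyβ := betaS_colon_curve_eq φ h₁ h₀ h₂ hgen hdim hgen' hdim hJμ' hne hδ hα
  rw [hJ'] at keyα keyβ
  exact ⟨keyα, keyβ⟩

end PointChartTransport

end Summit.ResolutionOfSingularities.ResolutionOfSingularities.Theorems
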